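import Literature.Computability.Complexity.StackNumeric
import Literature.Computability.Complexity.OracleReplay
import HarnessLib

/-!
# Oracle computations on stack programs: replaying recorded answers

Trunk `CplxCore`, toolkit for `Oracle.lean` (`OracleAlg.IsPolyTime`) and
`OracleComputations.lean`. The step function of the oracle algorithm of a computation tree
`c : OracleComp β` (`OracleComp.toOracleAlg`) maps the answers recorded so far to the next query
or to the output (`OracleComp.toStep`). A machine computing it *replays* `c`, consuming one
recorded answer at every query node, and stops at the first query for which no answer is left.
This file provides the bookkeeping for such machines.

* The replay of `c` against an answer list is `OracleComp.replay` of `OracleReplay.lean` (the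
  first unanswered query `Sum.inl q`, or the output with the unused answers `Sum.inr (b, as')`;
  `toStep` is its projection, `toStep_eq_replay`, and `replay_bind` is its bind law); this file
  adds the *raw* form below.
* The *raw* form of an answer list as a machine holds it: a pair of bit strings `(u, s)` — one
  bit of `u` per available answer (the unary length field of `Encoding.listBool`) and the
  iterated pairing `s` of the answers, read with `boolUnpair`. `rawAnswers u s` is the list so
  represented (total: every pair of strings represents some list; `rawAnswers_listBool`),
  `feedRaw` is the replay consuming raw answers, and `replay_rawAnswers` relates the two.
* For stack programs over the register type `EReg ⊕ (QReg ⊕ β)` — the numeric layer of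
  `StackNumeric.lean` whose outer bank is split into the five-register answer/output bank
  `QReg` and a user bank `β` — the predicate `Com.Impl P c σ T post B`: "the program `P`
  implements the replay of `c` from raw answers `σ` and user registers `T` within `B` steps":
  if the replay stops at a query `q`, `P` halts with `false :: q` (the encoding of `Sum.inl q`
  under `Encoding.sumBool`) in the output register; otherwise `P` runs normally, ending with
  the raw leftover answers in the answer bank and a user bank satisfying `post b`, `b` the
  output.
* Its composition rules — `impl_of_runs` (query-free steps), `impl_bind` (sequencing),
  `impl_bind_pure`, `Impl.of_pop_true/of_pop_nil` (branching on a flag), `impl_iterM` (counted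
  loops replaying `OracleComp.iterM`), `impl_forEach` — and the query
  primitive `qAsk` with its rule `impl_query`: consume the next raw answer into a user register
  if there is one; otherwise run a program writing the query to the output register, tag it,
  and halt.

The replay semantics on answer *lists* (`resume`, `replay`, `toStep_eq_replay`, `replay_bind`)
is that of `OracleReplay.lean`, the basis also of `Cryptography/ShorReplay.lean`; what is added
here is its raw-string form and the stack-program side, which no sibling `Stack*.lean` file
treats. The raw answer strings are split with `StackNumeric.nUnpair` (ordered components, total)
rather than `StackStrings.unpair` (reversed components) because `feedRaw` is stated with
`boolUnpair` verbatim.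

## References

* S. Arora, B. Barak, *Computational Complexity: A Modern Approach*, 2009, §3.4 (oracle Turing
  machines; a configuration is determined by the input and the answers received).
* T. Nipkow, G. Klein, *Concrete Semantics*, Springer 2014, Ch. 7 (big-step reasoning).
  (Folklore material, fully proved here.)
-/

namespace Literature.Computability.Complexity

open _root_.Computability

/-! ### Replaying a computation against recorded answers -/

namespace OracleComp

variable {α β γ σ : Type}

/-- `bind` on a leaf computes. [folklore] -/
@[simp] theorem pure_bind' (b : β) (f : β → OracleComp γ) : OracleComp.bind (pure b) f = f b := rfl

/-- `bind` on a query node pushes the continuation down. [folklore] -/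
@[simp] theorem query_bind' (q : List Bool) (k : List Bool → OracleComp β) (f : β → OracleComp γ) :
    OracleComp.bind (query q k) f = query q fun a => OracleComp.bind (k a) f := rfl

/-! ### Raw answer lists -/

/-- The answer list represented by the raw strings `(u, s)`: one answer per bit of `u`, split
off `s` by `boolUnpair`. [Arora–Barak 2009, §0.1 (tuples of strings)] [folklore] -/
def rawAnswers : List Bool → List Bool → List (List Bool)
  | [], _ => []
  | _ :: u, s => (boolUnpair s).1 :: rawAnswers u (boolUnpair s).2

/-- No count bit, no answer. [folklore] -/
@[simp] theorem rawAnswers_nil (s : List Bool) : rawAnswers [] s = [] := rfl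

/-- One count bit, one answer split off. [folklore] -/
@[simp] theorem rawAnswers_cons (b : Bool) (u s : List Bool) :
    rawAnswers (b :: u) s = (boolUnpair s).1 :: rawAnswers u (boolUnpair s).2 := rfl

/-- The raw strings of `Encoding.listBool` represent the encoded list: with `u` the unary
numeral of the length and `s` the iterated pairing of the answers. [folklore] -/
theorem rawAnswers_listBool (as : List (List Bool)) :
    rawAnswers (unaryEncodeNat as.length) (as.foldr (fun a acc => boolPair a acc) []) = as := by
  induction as with
  | nil => rfl
  | cons a as ih => simp [unaryEncodeNat, boolUnpair_boolPair, ih]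

/-- The two raw strings of the `listBool` encoding of a list of strings. [folklore] -/
theorem boolUnpair_listBool_encode (as : List (List Bool)) :
    boolUnpair ((encodingList Bool).listBool.encode as) =
      (unaryEncodeNat as.length, as.foldr (fun a acc => boolPair a acc) []) := by
  simp [Encoding.listBool, boolUnpair_boolPair, encodingList]

/-- `feedRaw c (u, s)`: the replay of `c` consuming raw answers — at a query, if a count bit is
left, the answer is `(boolUnpair s).1` and the raw state becomes `(u.tail, (boolUnpair s).2)`.
[folklore] -/
def feedRaw : OracleComp β → List Bool × List Bool → List Bool ⊕ (β × (List Bool × List Bool))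
  | pure b, σ => Sum.inr (b, σ)
  | query q k, σ =>
    match σ.1 with
    | [] => Sum.inl q
    | _ :: u => feedRaw (k (boolUnpair σ.2).1) (u, (boolUnpair σ.2).2)

/-- `feedRaw` of a leaf. [folklore] -/
@[simp] theorem feedRaw_pure (b : β) (σ : List Bool × List Bool) : feedRaw (pure b) σ = Sum.inr (b, σ) := by
  unfold feedRaw; rfl

/-- `feedRaw` of a query with no count bit left. [folklore] -/
@[simp] theorem feedRaw_query_nil (q : List Bool) (k : List Bool → OracleComp β) (s : List Bool) :
    feedRaw (query q k) ([], s) = Sum.inl q := by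
  rw [feedRaw]

/-- `feedRaw` of a query with a count bit left. [folklore] -/
@[simp] theorem feedRaw_query_cons (q : List Bool) (k : List Bool → OracleComp β) (b : Bool)
    (u s : List Bool) :
    feedRaw (query q k) (b :: u, s) = feedRaw (k (boolUnpair s).1) (u, (boolUnpair s).2) := by
  rw [feedRaw]

/-- **Raw replay is replay of the represented answers** (`OracleComp.replay` of
`OracleReplay.lean`). [folklore] -/
theorem replay_rawAnswers : ∀ (c : OracleComp β) (u s : List Bool),
    replay c (rawAnswers u s) =
      Sum.map id (Prod.map id fun σ => rawAnswers σ.1 σ.2) (feedRaw c (u, s))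
  | pure _, u, s => by simp
  | query _ _, [], s => by simp
  | query _ k, _ :: u, s => by
    rw [rawAnswers_cons, replay_query_cons, feedRaw_query_cons]
    exact replay_rawAnswers (k _) u _

/-- The raw replay is compositional. [folklore] -/
theorem feedRaw_bind (c : OracleComp β) (f : β → OracleComp γ) (σ : List Bool × List Bool) :
    feedRaw (OracleComp.bind c f) σ =
      match feedRaw c σ with
      | Sum.inl q => Sum.inl q
      | Sum.inr (b, σ') => feedRaw (f b) σ' := by
  induction c generalizing σ with
  | pure b => simp
  | query q k ih =>
    obtain ⟨u, s⟩ := σ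
    cases u with
    | nil => simp
    | cons b u => simpa using ih _ (u, (boolUnpair s).2)

/-- **The raw replay only consumes answers**: the leftover answer string is no longer than the
initial one. [folklore] -/
theorem feedRaw_snd_length_le : ∀ (c : OracleComp β) (σ : List Bool × List Bool) {b : β} {σ' : List Bool × List Bool},
    feedRaw c σ = Sum.inr (b, σ') → σ'.2.length ≤ σ.2.length
  | pure b, σ, b', σ', h => by simp at h; obtain ⟨-, rfl⟩ := h; exact le_rfl
  | query q k, ([], s), b', σ', h => by simp at h
  | query q k, (c :: u, s), b', σ', h => by
    rw [feedRaw_query_cons] at h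
    exact (feedRaw_snd_length_le (k _) _ h).trans ((Nat.le_add_left _ _).trans (length_boolUnpair_parts_le s))

/-- **The step function from the raw replay**: on the machine input of `OracleAlg.IsPolyTime`
(the answers `listBool`-encoded), `toStep` is read off `feedRaw` of the two raw strings.
[Arora–Barak 2009, §3.4] [folklore] -/
theorem toStep_eq_feedRaw (c : OracleComp β) (as : List (List Bool)) :
    toStep c as = Sum.map id Prod.fst
      (feedRaw c (unaryEncodeNat as.length, as.foldr (fun a acc => boolPair a acc) [])) := by
  rw [toStep_eq_replay, ← rawAnswers_listBool as, replay_rawAnswers, rawAnswers_listBool]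
  cases feedRaw c _ <;> rfl

end OracleComp

/-! ### The answer/output bank -/

/-- The five registers of the answer/output bank: `U` (one bit per available answer), `S` (the
paired answer strings), `A` and `S2` (scratch for splitting `S`), `OUT` (the output register).
[folklore] -/
inductive QReg where
  | U | S | A | S2 | OUT
  deriving DecidableEq, Fintype, Repr

namespace QReg

/-- A register file of the answer bank given register by register. [folklore] -/
def file (u s a s2 out : List Bool) : Regs QReg
  | .U => u | .S => s | .A => a | .S2 => s2 | .OUT => out

section FileLemmas

variable (u s a s2 out v : List Bool)

/-- Reading `U`. [folklore] -/ @[simp] theorem file_U : file u s a s2 out .U = u := rfl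
/-- Reading `S`. [folklore] -/ @[simp] theorem file_S : file u s a s2 out .S = s := rfl
/-- Reading `A`. [folklore] -/ @[simp] theorem file_A : file u s a s2 out .A = a := rfl
/-- Reading `S2`. [folklore] -/ @[simp] theorem file_S2 : file u s a s2 out .S2 = s2 := rfl
/-- Reading `OUT`. [folklore] -/ @[simp] theorem file_OUT : file u s a s2 out .OUT = out := rfl
/-- Writing `U`. [folklore] -/
@[simp] theorem update_file_U : Function.update (file u s a s2 out) .U v = file v s a s2 out := by
  funext r; cases r <;> rfl
/-- Writing `S`. [folklore] -/
@[simp] theorem update_file_S : Function.update (file u s a s2 out) .S v = file u v a s2 out := by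
  funext r; cases r <;> rfl
/-- Writing `A`. [folklore] -/
@[simp] theorem update_file_A : Function.update (file u s a s2 out) .A v = file u s v s2 out := by
  funext r; cases r <;> rfl
/-- Writing `S2`. [folklore] -/
@[simp] theorem update_file_S2 : Function.update (file u s a s2 out) .S2 v = file u s a v out := by
  funext r; cases r <;> rfl
/-- Writing `OUT`. [folklore] -/
@[simp] theorem update_file_OUT : Function.update (file u s a s2 out) .OUT v = file u s a s2 v := by
  funext r; cases r <;> rfl

end FileLemmas

end QReg

namespace Com

variable {β γ : Type}

/-! ### States of an oracle machine -/

/-- Name of an answer-bank register. [folklore] -/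
@[reducible] def rq (r : QReg) : EReg ⊕ (QReg ⊕ β) := Sum.inr (Sum.inl r)

/-- Name of a user register. [folklore] -/
@[reducible] def ru (r : β) : EReg ⊕ (QReg ⊕ β) := Sum.inr (Sum.inr r)

/-- The outer register file of an oracle machine assembled from the answer bank `Q` and the user
bank `T` (a definition, not reducible, so that `simp` does not oscillate between
`Sum.update_elim_inr` and `Sum.elim_update_right`). [folklore] -/
def ust (Q : Regs QReg) (T : Regs β) : Regs (QReg ⊕ β) := Sum.elim Q T

/-- `qs u s a s2 out T`: calculator banks clean, answer bank as given, user bank `T`. [folklore] -/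
abbrev qs (u s a s2 out : List Bool) (T : Regs β) : Regs (EReg ⊕ (QReg ⊕ β)) :=
  base (ust (QReg.file u s a s2 out) T)

/-- `qst σ T`: the state between two fragments of an oracle machine — raw answers `σ`, scratch
and output registers empty, user bank `T`. [folklore] -/
abbrev qst (σ : List Bool × List Bool) (T : Regs β) : Regs (EReg ⊕ (QReg ⊕ β)) :=
  qs σ.1 σ.2 [] [] [] T

section StateLemmas

variable (Q : Regs QReg) (v : List Bool) (T : Regs β)

/-- Reading an answer-bank register. [folklore] -/
@[simp] theorem ust_inl (r : QReg) : ust Q T (Sum.inl r) = Q r := rfl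

/-- Reading a user register. [folklore] -/
@[simp] theorem ust_inr (r : β) : ust Q T (Sum.inr r) = T r := rfl

/-- Two outer files agree iff their banks do. [folklore] -/
theorem ust_inj {Q Q' : Regs QReg} {T T' : Regs β} : ust Q T = ust Q' T' ↔ Q = Q' ∧ T = T' := by
  constructor
  · intro h
    exact ⟨funext fun r => congr_fun h (Sum.inl r), funext fun r => congr_fun h (Sum.inr r)⟩
  · rintro ⟨rfl, rfl⟩; rfl


variable [DecidableEq β]

/-- Writing an answer-bank register. [folklore] -/
@[simp] theorem update_ust_inl (r : QReg) :
    Function.update (ust Q T) (Sum.inl r) v = ust (Function.update Q r v) T := by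
  simp only [ust, Sum.update_elim_inl]

/-- Writing a user register. [folklore] -/
@[simp] theorem update_ust_inr (r : β) :
    Function.update (ust Q T) (Sum.inr r) v = ust Q (Function.update T r v) := by
  simp only [ust, Sum.update_elim_inr]

end StateLemmas

variable [DecidableEq β]

/-! ### Implementing a replay -/

/-- `Impl P c σ T post B`: from the state `qst σ T`, within `B` steps, the program `P` either
halts with `false :: q` in `OUT` if the raw replay of `c` from `σ` stops at the query `q`, or
runs normally to `qst σ' T'` with `post b T'` if the replay finishes with output `b` and raw
leftover `σ'`. [Arora–Barak 2009, §3.4] [folklore] -/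
def Impl (P : Com (EReg ⊕ (QReg ⊕ β))) (c : OracleComp γ) (σ : List Bool × List Bool) (T : Regs β)
    (post : γ → Regs β → Prop) (B : ℕ) : Prop :=
  match OracleComp.feedRaw c σ with
  | Sum.inl q => ∃ R', Halts P (qst σ T) R' B ∧ R' (rq .OUT) = false :: q
  | Sum.inr (b, σ') => ∃ T', Runs P (qst σ T) (qst σ' T') B ∧ post b T'

/-- Unfolding `Impl` when the replay stops at a query. [folklore] -/
theorem impl_of_inl {P : Com (EReg ⊕ (QReg ⊕ β))} {c : OracleComp γ} {σ : List Bool × List Bool} {T : Regs β}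
    {post : γ → Regs β → Prop} {B : ℕ} {q : List Bool} (h : OracleComp.feedRaw c σ = Sum.inl q) :
    Impl P c σ T post B ↔ ∃ R', Halts P (qst σ T) R' B ∧ R' (rq .OUT) = false :: q := by
  unfold Impl; rw [h]

/-- Unfolding `Impl` when the replay finishes. [folklore] -/
theorem impl_of_inr {P : Com (EReg ⊕ (QReg ⊕ β))} {c : OracleComp γ} {σ : List Bool × List Bool} {T : Regs β}
    {post : γ → Regs β → Prop} {B : ℕ} {b : γ} {σ' : List Bool × List Bool}
    (h : OracleComp.feedRaw c σ = Sum.inr (b, σ')) :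
    Impl P c σ T post B ↔ ∃ T', Runs P (qst σ T) (qst σ' T') B ∧ post b T' := by
  unfold Impl; rw [h]

/-- Larger budgets. [folklore] -/
theorem Impl.mono {P : Com (EReg ⊕ (QReg ⊕ β))} {c : OracleComp γ} {σ : List Bool × List Bool} {T : Regs β}
    {post : γ → Regs β → Prop} {B B' : ℕ} (h : Impl P c σ T post B) (hB : B ≤ B') : Impl P c σ T post B' := by
  unfold Impl at h ⊢
  split
  · rename_i q hq
    rw [hq] at h
    obtain ⟨R', hR, ho⟩ := h
    exact ⟨R', hR.mono hB, ho⟩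
  · rename_i b σ' hq
    rw [hq] at h
    obtain ⟨T', hR, hp⟩ := h
    exact ⟨T', hR.mono hB, hp⟩

/-- Weakening the postcondition. [folklore] -/
theorem Impl.weaken {P : Com (EReg ⊕ (QReg ⊕ β))} {c : OracleComp γ} {σ : List Bool × List Bool} {T : Regs β}
    {post post' : γ → Regs β → Prop} {B : ℕ} (h : Impl P c σ T post B) (hp : ∀ b T', post b T' → post' b T') :
    Impl P c σ T post' B := by
  unfold Impl at h ⊢
  split
  · rename_i q hq
    rw [hq] at h
    exact h
  · rename_i b σ' hq
    rw [hq] at h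
    obtain ⟨T', hR, hpost⟩ := h
    exact ⟨T', hR, hp _ _ hpost⟩

/-- **Query-free steps.** A normal run that keeps the answer bank implements `pure b` for any
postcondition it establishes. [folklore] -/
theorem impl_of_runs {P : Com (EReg ⊕ (QReg ⊕ β))} {b : γ} {σ : List Bool × List Bool} {T T' : Regs β}
    {post : γ → Regs β → Prop} {B : ℕ} (h : Runs P (qst σ T) (qst σ T') B) (hp : post b T') :
    Impl P (OracleComp.pure b) σ T post B := by
  rw [impl_of_inr (OracleComp.feedRaw_pure b σ)]
  exact ⟨T', h, hp⟩

/-- **Sequencing.** If `P` implements `c` with intermediate condition `mid`, and from every state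
satisfying `mid b` (with no more raw answers than before) the program `P'` implements `f b`,
then `P ;; P'` implements `c >>= f`.
[Nipkow–Klein 2014, §7.2; folklore] [folklore] -/
theorem impl_bind {P P' : Com (EReg ⊕ (QReg ⊕ β))} {c : OracleComp γ} {α' : Type} {f : γ → OracleComp α'}
    {σ : List Bool × List Bool} {T : Regs β} {mid : γ → Regs β → Prop} {post : α' → Regs β → Prop} {B₁ B₂ : ℕ}
    (h₁ : Impl P c σ T mid B₁)
    (h₂ : ∀ b σ' T', σ'.2.length ≤ σ.2.length → mid b T' → Impl P' (f b) σ' T' post B₂) :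
    Impl (P ;; P') (OracleComp.bind c f) σ T post (B₁ + B₂) := by
  unfold Impl at h₁ ⊢
  rw [OracleComp.feedRaw_bind]
  rcases hc : OracleComp.feedRaw c σ with q | ⟨b, σ'⟩
  · rw [hc] at h₁
    obtain ⟨R', hR, ho⟩ := h₁
    exact ⟨R', (hR.seq P').mono (by omega), ho⟩
  · rw [hc] at h₁
    obtain ⟨T', hR, hmid⟩ := h₁
    have h := h₂ b σ' T' (OracleComp.feedRaw_snd_length_le c σ hc) hmid
    unfold Impl at h
    dsimp only
    rcases hf : OracleComp.feedRaw (f b) σ' with q | ⟨b', σ''⟩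
    · rw [hf] at h
      obtain ⟨R', hR', ho⟩ := h
      exact ⟨R', hR.seq_halts hR', ho⟩
    · rw [hf] at h
      obtain ⟨T'', hR', hp⟩ := h
      exact ⟨T'', hR.seq hR', hp⟩

/-- Sequencing a query-free preparation before an implementation. [folklore] -/
theorem impl_runs_seq {P P' : Com (EReg ⊕ (QReg ⊕ β))} {c : OracleComp γ} {σ : List Bool × List Bool}
    {T T₁ : Regs β} {post : γ → Regs β → Prop} {B₁ B₂ : ℕ}
    (h₁ : Runs P (qst σ T) (qst σ T₁) B₁) (h₂ : Impl P' c σ T₁ post B₂) :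
    Impl (P ;; P') c σ T post (B₁ + B₂) := by
  unfold Impl at h₂ ⊢
  rcases hc : OracleComp.feedRaw c σ with q | ⟨b, σ'⟩
  · rw [hc] at h₂
    obtain ⟨R', hR, ho⟩ := h₂
    exact ⟨R', h₁.seq_halts hR, ho⟩
  · rw [hc] at h₂
    obtain ⟨T', hR, hp⟩ := h₂
    exact ⟨T', h₁.seq hR, hp⟩

/-- Appending a query-free finish after an implementation. [folklore] -/
theorem impl_seq_runs {P P' : Com (EReg ⊕ (QReg ⊕ β))} {c : OracleComp γ} {σ : List Bool × List Bool}
    {T : Regs β} {mid post : γ → Regs β → Prop} {B₁ B₂ : ℕ}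
    (h₁ : Impl P c σ T mid B₁)
    (h₂ : ∀ b σ' T', mid b T' → ∃ T'', Runs P' (qst σ' T') (qst σ' T'') B₂ ∧ post b T'') :
    Impl (P ;; P') c σ T post (B₁ + B₂) := by
  unfold Impl at h₁ ⊢
  rcases hc : OracleComp.feedRaw c σ with q | ⟨b, σ'⟩
  · rw [hc] at h₁
    obtain ⟨R', hR, ho⟩ := h₁
    exact ⟨R', (hR.seq P').mono (by omega), ho⟩
  · rw [hc] at h₁
    obtain ⟨T', hR, hmid⟩ := h₁
    obtain ⟨T'', hR', hp⟩ := h₂ b σ' T' hmid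
    exact ⟨T'', hR.seq hR', hp⟩

/-- **Binding with a query-free function**: an implementation of `c` with intermediate
condition `mid` implements `c >>= pure ∘ f` for every postcondition that `mid` implies on the
images. [folklore] -/
theorem impl_bind_pure {P : Com (EReg ⊕ (QReg ⊕ β))} {c : OracleComp γ} {α' : Type} {f : γ → α'}
    {σ : List Bool × List Bool} {T : Regs β} {mid : γ → Regs β → Prop} {post : α' → Regs β → Prop} {B : ℕ}
    (h : Impl P c σ T mid B) (hp : ∀ b T', mid b T' → post (f b) T') :
    Impl P (OracleComp.bind c fun b => OracleComp.pure (f b)) σ T post B := by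
  unfold Impl at h ⊢
  rw [OracleComp.feedRaw_bind]
  rcases hc : OracleComp.feedRaw c σ with q | ⟨b, σ'⟩
  · rw [hc] at h; exact h
  · rw [hc] at h
    obtain ⟨T', hR, hmid⟩ := h
    exact ⟨T', by simpa using hR, hp _ _ hmid⟩

/-- Branching on a set flag in a user register: the `true` branch implements. [folklore] -/
theorem Impl.of_pop_true {ct cf cn : Com (EReg ⊕ (QReg ⊕ β))} {c : OracleComp γ} {σ : List Bool × List Bool}
    {T : Regs β} {F : β} {post : γ → Regs β → Prop} {B : ℕ} (hk : T F = [true])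
    (h : Impl ct c σ (Function.update T F []) post B) : Impl (pop (ru F) ct cf cn) c σ T post (B + 2) := by
  have hk' : qst σ T (ru F) = true :: [] := by simp [ru, hk]
  have hupd : Function.update (qst σ T) (ru F) [] = qst σ (Function.update T F []) := by simp [ru]
  unfold Impl at h ⊢
  rcases hc : OracleComp.feedRaw c σ with q | ⟨b, σ'⟩
  · rw [hc] at h
    obtain ⟨R', hR, ho⟩ := h
    exact ⟨R', Halts.pop_true' cf cn hk' hupd hR, ho⟩
  · rw [hc] at h
    obtain ⟨T', hR, hpost⟩ := h
    exact ⟨T', Runs.pop_true' cf cn hk' hupd hR, hpost⟩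

/-- Branching on a cleared flag in a user register: the `nil` branch implements. [folklore] -/
theorem Impl.of_pop_nil {ct cf cn : Com (EReg ⊕ (QReg ⊕ β))} {c : OracleComp γ} {σ : List Bool × List Bool}
    {T : Regs β} {F : β} {post : γ → Regs β → Prop} {B : ℕ} (hk : T F = [])
    (h : Impl cn c σ T post B) : Impl (pop (ru F) ct cf cn) c σ T post (B + 2) := by
  have hk' : qst σ T (ru F) = [] := by simp [ru, hk]
  unfold Impl at h ⊢
  rcases hc : OracleComp.feedRaw c σ with q | ⟨b, σ'⟩
  · rw [hc] at h
    obtain ⟨R', hR, ho⟩ := h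
    exact ⟨R', Halts.pop_nil ct cf hk' hR, ho⟩
  · rw [hc] at h
    obtain ⟨T', hR, hpost⟩ := h
    exact ⟨T', Runs.pop_nil ct cf hk' hR, hpost⟩

/-! ### Counted loops replaying `iterM` and `forEach` -/

/-- **Counted loops over `iterM`.** Suppose the body, started with any contents `w` of the
counter register `C` (which it does not touch) on a state satisfying the invariant `inv j s`,
implements `f s` and re-establishes `inv (j+1) s'` for the new loop state `s'` (for `j < N`,
with at most `L` raw answer bits). Then `loop C body body` with a counter of length `n`
implements `iterM f n s` from `inv j s` to `inv (j + n)`, in `n (cost + 2) + 1` steps.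
[folklore] -/
theorem impl_iterM {σS : Type} (C : β) (body : Com (EReg ⊕ (QReg ⊕ β))) (f : σS → OracleComp σS)
    (inv : ℕ → σS → Regs β → Prop) (cost N L : ℕ)
    (hC : ∀ j s T, inv j s T → T C = [])
    (hbody : ∀ j s (σ : List Bool × List Bool) T (w : List Bool), j < N → σ.2.length ≤ L → inv j s T →
      Impl body (f s) σ (Function.update T C w)
        (fun s' T' => T' C = w ∧ inv (j + 1) s' (Function.update T' C [])) cost) :
    ∀ (w : List Bool) (j : ℕ) (s : σS) (σ : List Bool × List Bool) (T : Regs β), j + w.length ≤ N →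
      σ.2.length ≤ L → inv j s T →
      Impl (loop (ru C) body body) (OracleComp.iterM f w.length s) σ (Function.update T C w)
        (fun s' T' => inv (j + w.length) s' T') (w.length * (cost + 2) + 1)
  | [], j, s, σ, T, _, _, hinv => by
    have e : Function.update T C [] = T := by rw [← hC j s T hinv, Function.update_eq_self]
    rw [e]
    refine impl_of_runs ((Runs.loop_nil _ _ ?_).of_eq rfl (by simp)) (by simpa using hinv)
    simp [hC j s T hinv]
  | b :: w, j, s, σ, T, hj, hL, hinv => by
    have hjN : j < N := by simp at hj; omega
    have hb := hbody j s σ T w hjN hL hinv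
    -- `iterM f (|w|+1) s = f s >>= iterM f |w|`
    show Impl _ (OracleComp.bind (f s) fun s' => OracleComp.iterM f w.length s') _ _ _ _
    unfold Impl at hb ⊢
    rw [OracleComp.feedRaw_bind]
    have hk : qst σ (Function.update T C (b :: w)) (ru C) = b :: w := by simp [ru]
    have hupd : Function.update (qst σ (Function.update T C (b :: w))) (ru C) w =
        qst σ (Function.update T C w) := by simp [ru]
    rcases hf : OracleComp.feedRaw (f s) σ with q | ⟨s', σ'⟩
    · rw [hf] at hb
      obtain ⟨R', hR, ho⟩ := hb
      refine ⟨R', ?_, ho⟩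
      cases b
      · exact (Halts.loop_false' _ hk hupd hR).mono (by simp [Nat.succ_mul]; omega)
      · exact (Halts.loop_true' _ hk hupd hR).mono (by simp [Nat.succ_mul]; omega)
    · rw [hf] at hb
      obtain ⟨T', hR, hC', hinv'⟩ := hb
      have ih := impl_iterM C body f inv cost N L hC hbody w (j + 1) s' σ' (Function.update T' C [])
        (by simp at hj ⊢; omega) ((OracleComp.feedRaw_snd_length_le _ _ hf).trans hL) hinv'
      have eT' : Function.update (Function.update T' C []) C w = T' := by
        rw [Function.update_idem, ← hC', Function.update_eq_self]
      rw [eT'] at ih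
      have elen : j + 1 + w.length = j + (b :: w).length := by simp; omega
      rw [elen] at ih
      unfold Impl at ih
      dsimp only
      rcases hr : OracleComp.feedRaw (OracleComp.iterM f w.length s') σ' with q | ⟨s'', σ''⟩
      · rw [hr] at ih
        obtain ⟨R', hR', ho⟩ := ih
        refine ⟨R', ?_, ho⟩
        cases b
        · exact (Runs.loop_false_halts' hk hupd hR hR').mono (by simp [Nat.succ_mul]; omega)
        · exact (Runs.loop_true_halts' hk hupd hR hR').mono (by simp [Nat.succ_mul]; omega)
      · rw [hr] at ih
        obtain ⟨T'', hR', hp⟩ := ih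
        refine ⟨T'', ?_, hp⟩
        cases b
        · exact (Runs.loop_false' hk hupd hR hR').mono (by simp [Nat.succ_mul]; omega)
        · exact (Runs.loop_true' hk hupd hR hR').mono (by simp [Nat.succ_mul]; omega)

/-- **Counted loops over `forEach`.** Processing the list `l` from position `d` on: if the body,
started with any counter contents `w` on a state satisfying `inv done` (`done` the results so
far, `|done| < |l|`, at most `L` raw answer bits), implements `f l[|done|]` and re-establishes
`inv (done ++ [b])`, then the
loop with a counter of length `|l| - |done|` implements `forEach f (l.drop |done|)` from
`inv done` to `inv (done ++ results)` (with `|results| = |l| - |done|`). [folklore] -/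
theorem impl_forEach {α' : Type} (C : β) (body : Com (EReg ⊕ (QReg ⊕ β))) (f : α' → OracleComp γ) (l : List α')
    (inv : List γ → Regs β → Prop) (cost L : ℕ)
    (hC : ∀ done T, inv done T → T C = [])
    (hbody : ∀ (done : List γ) (σ : List Bool × List Bool) T (w : List Bool) (hd : done.length < l.length),
      σ.2.length ≤ L → inv done T →
      Impl body (f (l[done.length])) σ (Function.update T C w)
        (fun b T' => T' C = w ∧ inv (done ++ [b]) (Function.update T' C [])) cost) :
    ∀ (w : List Bool) (done : List γ) (σ : List Bool × List Bool) (T : Regs β),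
      done.length + w.length = l.length → σ.2.length ≤ L → inv done T →
      Impl (loop (ru C) body body) (OracleComp.forEach f (l.drop done.length)) σ (Function.update T C w)
        (fun bs T' => bs.length = w.length ∧ inv (done ++ bs) T') (w.length * (cost + 2) + 1)
  | [], done, σ, T, hlen, _, hinv => by
    have e : Function.update T C [] = T := by rw [← hC done T hinv, Function.update_eq_self]
    have hdrop : l.drop done.length = [] := List.drop_eq_nil_iff.2 (by simp at hlen; omega)
    rw [e, hdrop]
    refine impl_of_runs ((Runs.loop_nil _ _ ?_).of_eq rfl (by simp)) (by simpa using hinv)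
    simp [hC done T hinv]
  | b :: w, done, σ, T, hlen, hL, hinv => by
    have hd : done.length < l.length := by simp at hlen; omega
    have hb := hbody done σ T w hd hL hinv
    have hdrop : l.drop done.length = l[done.length] :: l.drop (done.length + 1) :=
      (List.getElem_cons_drop hd).symm
    rw [hdrop]
    show Impl _ (OracleComp.bind (f l[done.length]) fun r =>
      OracleComp.bind (OracleComp.forEach f (l.drop (done.length + 1))) fun rs => OracleComp.pure (r :: rs)) _ _ _ _
    unfold Impl at hb ⊢
    rw [OracleComp.feedRaw_bind]
    have hk : qst σ (Function.update T C (b :: w)) (ru C) = b :: w := by simp [ru]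
    have hupd : Function.update (qst σ (Function.update T C (b :: w))) (ru C) w =
        qst σ (Function.update T C w) := by simp [ru]
    rcases hf : OracleComp.feedRaw (f l[done.length]) σ with q | ⟨r, σ'⟩
    · rw [hf] at hb
      obtain ⟨R', hR, ho⟩ := hb
      refine ⟨R', ?_, ho⟩
      cases b
      · exact (Halts.loop_false' _ hk hupd hR).mono (by simp [Nat.succ_mul]; omega)
      · exact (Halts.loop_true' _ hk hupd hR).mono (by simp [Nat.succ_mul]; omega)
    · rw [hf] at hb
      obtain ⟨T', hR, hC', hinv'⟩ := hb
      have ih := impl_forEach C body f l inv cost L hC hbody w (done ++ [r]) σ' (Function.update T' C [])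
        (by simp at hlen ⊢; omega) ((OracleComp.feedRaw_snd_length_le _ _ hf).trans hL) hinv'
      have eT' : Function.update (Function.update T' C []) C w = T' := by
        rw [Function.update_idem, ← hC', Function.update_eq_self]
      rw [eT'] at ih
      have elen : (done ++ [r]).length = done.length + 1 := by simp
      rw [elen] at ih
      unfold Impl at ih
      dsimp only
      rw [OracleComp.feedRaw_bind]
      rcases hr : OracleComp.feedRaw (OracleComp.forEach f (l.drop (done.length + 1))) σ' with q | ⟨rs, σ''⟩
      · rw [hr] at ih
        obtain ⟨R', hR', ho⟩ := ih
        refine ⟨R', ?_, ho⟩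
        cases b
        · exact (Runs.loop_false_halts' hk hupd hR hR').mono (by simp [Nat.succ_mul]; omega)
        · exact (Runs.loop_true_halts' hk hupd hR hR').mono (by simp [Nat.succ_mul]; omega)
      · rw [hr] at ih
        obtain ⟨T'', hR', hlen', hp⟩ := ih
        simp only [OracleComp.feedRaw_pure]
        refine ⟨T'', ?_, by simpa using hlen', by simpa using hp⟩
        cases b
        · exact (Runs.loop_false' hk hupd hR hR').mono (by simp [Nat.succ_mul]; omega)
        · exact (Runs.loop_true' hk hupd hR hR').mono (by simp [Nat.succ_mul]; omega)

/-! ### The query primitive -/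

/-- Consume the next raw answer into the user register `ans`: split `S` into the answer and the
rest, put the rest back into `S`, and move the answer to `ans` (cleared first). [folklore] -/
def qConsume (ans : β) : Com (EReg ⊕ (QReg ⊕ β)) :=
  nUnpair (Sum.inl QReg.S) (Sum.inl QReg.A) (Sum.inl QReg.S2) ;;
  move (rq .S2) (rq .S) (ra .s) ;; clear (ru ans) ;; move (rq .A) (ru ans) (ra .s)

/-- **The query primitive** `qAsk ans build`: if a count bit is left in `U`, drop it and consume
the next answer into `ans`; otherwise run `build` (which must leave the query in `OUT`), push
the tag `false` of `Sum.inl`, and halt. [Arora–Barak 2009, §3.4 (the query state)] [folklore] -/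
def qAsk (ans : β) (build : Com (EReg ⊕ (QReg ⊕ β))) : Com (EReg ⊕ (QReg ⊕ β)) :=
  pop (rq .U) (qConsume ans) (qConsume ans) (build ;; push (rq .OUT) false ;; halt)

/-- Effect of `qConsume`, in `23 |s| + 2 |T ans| + 12` steps. [folklore] -/
theorem runs_qConsume (ans : β) (u s : List Bool) (T : Regs β) :
    Runs (qConsume ans) (qs u s [] [] [] T)
      (qst (u, (boolUnpair s).2) (Function.update T ans (boolUnpair s).1))
      (23 * s.length + 2 * (T ans).length + 12) := by
  have hl1 : 2 * (boolUnpair s).1.length ≤ s.length :=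
    (Nat.le_add_right _ _).trans (length_boolUnpair_parts_le s)
  have hl2 : (boolUnpair s).2.length ≤ s.length :=
    (Nat.le_add_left _ _).trans (length_boolUnpair_parts_le s)
  have h1 : Runs (nUnpair (β := QReg ⊕ β) (Sum.inl QReg.S) (Sum.inl QReg.A) (Sum.inl QReg.S2)) (qs u s [] [] [] T)
      (qs u [] (boolUnpair s).1 (boolUnpair s).2 [] T) (9 * s.length + 7) :=
    (runs_nUnpair (by simp) (by simp) (by simp) _ rfl rfl).of_eq (by simp) (by simp)
  have h2 : Runs (move (rq .S2) (rq .S) (ra .s)) (qs u [] (boolUnpair s).1 (boolUnpair s).2 [] T)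
      (qs u (boolUnpair s).2 (boolUnpair s).1 [] [] T) (6 * (boolUnpair s).2.length + 2) :=
    (runs_move (by simp [rq]) (by simp [rq, ra]) (by simp [rq, ra]) _ rfl).of_eq (by simp [rq]) (by simp [rq])
  have h3 : Runs (clear (ru ans)) (qs u (boolUnpair s).2 (boolUnpair s).1 [] [] T)
      (qs u (boolUnpair s).2 (boolUnpair s).1 [] [] (Function.update T ans [])) (2 * (T ans).length + 1) :=
    (runs_clear (ru ans) _).of_eq (by simp [ru]) (by simp [ru])
  have h4 : Runs (move (rq .A) (ru ans) (ra .s)) (qs u (boolUnpair s).2 (boolUnpair s).1 [] [] (Function.update T ans []))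
      (qst (u, (boolUnpair s).2) (Function.update T ans (boolUnpair s).1)) (6 * (boolUnpair s).1.length + 2) :=
    (runs_move (by simp [rq, ru]) (by simp [rq, ra]) (by simp [ru, ra]) _ rfl).of_eq (by simp [rq, ru]) (by simp [rq])
  exact (h1.seq (h2.seq (h3.seq h4))).of_eq rfl (by omega)

/-- **The query rule.** To implement `query q k` from raw answers `σ`: if no count bit is left,
`build` must write `q` into the (empty) output register; if one is, `body` must implement the
continuation on the consumed answer, from the user bank with the answer in `ans`.
[Arora–Barak 2009, §3.4] [folklore] -/
theorem impl_query (ans : β) {q : List Bool} {k : List Bool → OracleComp γ}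
    {build body : Com (EReg ⊕ (QReg ⊕ β))} {σ : List Bool × List Bool} {T : Regs β}
    {post : γ → Regs β → Prop} {B₁ B₂ : ℕ}
    (hbuild : σ.1 = [] → ∃ T₁, Runs build (qst σ T) (qs [] σ.2 [] [] q T₁) B₁)
    (hbody : ∀ b u, σ.1 = b :: u →
      Impl body (k (boolUnpair σ.2).1) (u, (boolUnpair σ.2).2) (Function.update T ans (boolUnpair σ.2).1) post B₂) :
    Impl (qAsk ans build ;; body) (OracleComp.query q k) σ T post
      (B₁ + 23 * σ.2.length + 2 * (T ans).length + 16 + B₂) := by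
  obtain ⟨u, s⟩ := σ
  unfold Impl
  cases u with
  | nil =>
    rw [OracleComp.feedRaw_query_nil]
    obtain ⟨T₁, hb⟩ := hbuild rfl
    have hpush : Runs (push (rq .OUT) false) (qs [] s [] [] q T₁) (qs [] s [] [] (false :: q) T₁) 1 :=
      Runs.push' (by simp [rq])
    have hhalt : Halts (build ;; push (rq .OUT) false ;; halt) (qst ([], s) T) (qs [] s [] [] (false :: q) T₁) (B₁ + 1 + 1) :=
      hb.seq_halts (hpush.seq_halts (Halts.halt _))
    refine ⟨qs [] s [] [] (false :: q) T₁, ?_, by simp [rq]⟩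
    exact ((Halts.pop_nil _ _ (by simp [rq]) hhalt).seq body).mono (by omega)
  | cons b u =>
    rw [OracleComp.feedRaw_query_cons]
    have hb := hbody b u rfl
    unfold Impl at hb
    have hc := runs_qConsume ans u s T
    have hk : qst (b :: u, s) T (rq .U) = b :: u := by simp [rq]
    have hupd : Function.update (qst (b :: u, s) T) (rq .U) u = qs u s [] [] [] T := by simp [rq]
    have hask : Runs (qAsk ans build) (qst (b :: u, s) T)
        (qst (u, (boolUnpair s).2) (Function.update T ans (boolUnpair s).1)) (23 * s.length + 2 * (T ans).length + 12 + 2) := by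
      cases b
      · exact Runs.pop_false' _ _ hk hupd hc
      · exact Runs.pop_true' _ _ hk hupd hc
    dsimp only at hb ⊢
    rcases hf : OracleComp.feedRaw (k (boolUnpair s).1) (u, (boolUnpair s).2) with q' | ⟨b', σ'⟩
    · rw [hf] at hb
      obtain ⟨R', hR, ho⟩ := hb
      exact ⟨R', (hask.seq_halts hR).mono (by omega), ho⟩
    · rw [hf] at hb
      obtain ⟨T', hR, hp⟩ := hb
      exact ⟨T', (hask.seq hR).mono (by omega), hp⟩

end Com

end Literature.Computability.Complexity
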